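import Summits.AtomisticToContinuum.Crystallization.Theorems.ChargedEnergyGapHoleBand
import Summits.AtomisticToContinuum.Crystallization.Theorems.ChargedEnergyGapBands5
import Summits.AtomisticToContinuum.Crystallization.Theorems.ChargedEnergyGapBlockExhibition
import HarnessLib

/-!
# Charged energy gap — lens-3 g65, node «BarlowRef» (R3) — part 28e «ResidualClosed»: THE (R3) RESIDUAL OF RECORD, DISCHARGED

Line `stmt-AtomisticToContinuum-14231`, NODE 64 «BarlowRef» (R3).  ★★★ `bulkFarResidueBoundB_record`:
`BulkFarResidueBoundB (3/5) (1/3) 3 (1/100) 160 80 (1/2100) (1/46) (5·10⁷·226981)` — the bulk far-residue bound of record — from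
* ITEM 4, the tube block exhibition of record (part 28d `tubeBlockExhibition_record`, two-band table `{U, H}`);
* ITEM 2, the share bounds of the two bands: `U = (0, 0, 60, 1/2100)` — part 26e `tubeShareBoundH_bandU_record` (kernel table of record,
  `θ̂_U = 0.9696 < 1`); `H = (0, 0, 40, 5·10⁷)` — `tubeShareBoundH_hole40` below (part 27 `tubeLoad_uncored_le` at clearance `40`);
* ITEM 1, part 25 `bulkFarResidueBoundB_of_tubeBlockExhibition`.
Hence ★★★ `rotationFamilyB_record`: the record (R3) rotation sub-family `RotationFamilyB (3/5) (1/3) 3 (1/100) (3/100) (1/2) 160 (2/5) 3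
(1/3000000) 80 (1/100000)` holds OUTRIGHT (`rotationFamilyB_record_of_bulkBoundB`, P-N‴ §R4) — the residual of NODE 64 is closed.
ELEMENTARY · PROVED, 0 sorry, standard axioms.
-/

noncomputable section

open scoped Classical

open Literature.MathematicalPhysics.StatisticalMechanics Literature.Geometry.DiscreteGeometry
open Summit.AtomisticToContinuum.Crystallization.Theses.PricedLinkCensus
open Summit.AtomisticToContinuum.Crystallization.Theorems.ChargedEnergyGapNegative

namespace Summit.AtomisticToContinuum.Crystallization.Theorems.ChargedEnergyGapChartDial

section ResidualClosed

/-- RECORD ARITHMETIC: at `s = 3/5`, `b₀ = 40` the uncored load bound is `≤ 5·10⁷` (`π < 3.1416`; numerically `≈ 4.945·10⁷`). -/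
theorem uncored_record_arith40 :
    ((2 * 400 + 3 / 5) / (3 / 5) : ℝ) ^ 3 * (500 * Real.pi / 21 / (40 - 101 / 5) ^ 3 / (463 / 1000)) + 3 / 50 / (463 / 1000) ^ 2 ≤ 50000000 := by
  have hπ := Real.pi_lt_d4
  have h1 : ((2 * 400 + 3 / 5) / (3 / 5) : ℝ) ^ 3 * (500 * Real.pi / 21 / (40 - 101 / 5) ^ 3 / (463 / 1000)) ≤
      ((2 * 400 + 3 / 5) / (3 / 5) : ℝ) ^ 3 * (500 * 3.1416 / 21 / (40 - 101 / 5) ^ 3 / (463 / 1000)) := by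
    gcongr
  have h2 : ((2 * 400 + 3 / 5) / (3 / 5) : ℝ) ^ 3 * (500 * 3.1416 / 21 / (40 - 101 / 5) ^ 3 / (463 / 1000)) + 3 / 50 / (463 / 1000) ^ 2 ≤
      50000000 := by norm_num
  linarith

/-- ★ **THE HOLE BAND AT CLEARANCE `40`**: `TubeShareBoundH (3/5) (101/5) ϱ' ℓ 40 18 (5·10⁷)` for every core pair — the targets' clearance `40`
from the member alone bounds the load (part 27), and the block count is `≥ 1`. -/
theorem tubeShareBoundH_hole40 (ϱ' ℓ : ℝ) : TubeShareBoundH (3 / 5) (101 / 5) ϱ' ℓ 40 18 50000000 := by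
  intro P hsep hBar x₀ c q F G hF hG hq _ _ hGb _
  have h1 := tubeLoad_uncored_le (by norm_num) hsep hBar c (b₀ := 40) (by norm_num) F G hF hG hGb
  have hN : (1 : ℝ) ≤ ((P.points ∩ Metric.closedBall q 18).ncard : ℝ) := by
    have hfin := hsep.finite_inter_closedBall (by norm_num : (0 : ℝ) < 3 / 5) q 18
    exact_mod_cast (Set.ncard_pos hfin).2 ⟨q, hq, Metric.mem_closedBall_self (by norm_num)⟩
  calc tubeLoad (101 / 5) c F G ≤ 50000000 := h1.trans uncored_record_arith40
    _ ≤ 50000000 * ((P.points ∩ Metric.closedBall q 18).ncard : ℝ) := by nlinarith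

/-- ★★★ **THE (R3) BULK FAR-RESIDUE BOUND OF RECORD** `BulkFarResidueBoundB (3/5) (1/3) 3 (1/100) 160 80 (1/2100) (1/46) (5·10⁷·226981)`:
items 1 (part 25), 2 (parts 26e-U and `tubeShareBoundH_hole40`) and 4 (part 28d). -/
theorem bulkFarResidueBoundB_record : BulkFarResidueBoundB (3 / 5) (1 / 3) 3 (1 / 100) 160 80 (1 / 2100) (1 / 46) (50000000 * 226981) := by
  refine bulkFarResidueBoundB_of_tubeBlockExhibition (by norm_num) (by norm_num) (by norm_num) (by norm_num) (by norm_num)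
    (fun i => ?_) (fun i _ => ?_) tubeBlockExhibition_record (fun i _ => ?_)
  · unfold bandRate
    split_ifs <;> norm_num
  · unfold bandClearance
    split_ifs <;> norm_num
  · cases i
    · simpa only [bandClearance, bandRate, Bool.false_eq_true, if_false] using tubeShareBoundH_bandU_record
    · simpa only [bandClearance, bandRate, if_true] using tubeShareBoundH_hole40 0 0

/-- ★★★ **NODE 64 «BarlowRef» (R3) — THE RESIDUAL OF RECORD IS CLOSED**: the record rotation sub-family holds outright. -/
theorem rotationFamilyB_record : RotationFamilyB (3 / 5) (1 / 3) 3 (1 / 100) (3 / 100) (1 / 2) 160 (2 / 5) 3 (1 / 3000000) 80 (1 / 100000) :=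
  rotationFamilyB_record_of_bulkBoundB (by norm_num) bulkFarResidueBoundB_record

end ResidualClosed

end Summit.AtomisticToContinuum.Crystallization.Theorems.ChargedEnergyGapChartDial

end
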